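import Summits.ResolutionOfSingularities.ResolutionOfSingularities.Theorems.EquisingularLiftEquisingularLiftNatTangentConeFibre
import HarnessLib

/-!
# [OURS · L1 W4.5(b) · EL♮] T-TCONE, part 2: the REDUCED exceptional trace `Z = (e ∩ St(W))_red` of a strict transform under a
# point blow-up is cut out by the square-free part of the initial form — crux `EquisingularLiftNat` = stmt-ResolutionOfSingularities-20038

HONEST FRAMING. OURS (cell res-hironaka, crux chain w45b, slot W4.5(b)); NOT a statement of any manuscript; AI-written, weaker than
expert review. Helper `--supports stmt-ResolutionOfSingularities-20038 --as helper`; it closes nothing. Object = res-L1-w45b-lead-2's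
brick **T-TCONE** (2) (STATUS 2026-08-27T08:06:58Z / 08:14:45Z «vanishingIdeal of `e ∩ St(W)` = `𝓘_e + (g)`, `g` := square-free part
of `in_d w`»); consumer: res-D-pv-029's (v) `C.comap j₂ = Z` in T-INST (`Z := vanishingIdeal ⟨υ⁻¹{x} ∩ closure υ⁻¹(W ∖ {x}), hZ⟩`,
`…NatDeltaPointResolutionStrong` p514266). Part 1 = `…NatTangentConeFibre` (ideal- and set-level statements).

CONTENT. Point centre `J = 𝓘_{x}` (`x` closed), `υ : F' → F` the blow-up (`IsBlowup υ J`), `F'` locally Noetherian, `R = 𝒪_{F,x}`,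
`c = (c₁, …, c_r)` a quasi-regular system of generators of `𝔪_x` (so `k := R/(c)` is the residue field), `W ⊆ F` closed with
`𝓘(W)_x = (Φ(c))` for a form `Φ` of degree `d` with reduction `φ := Φ̄ ≠ 0` in `k[T]` (the initial form), and `G ∈ R[T]` ANY polynomial
with reduction `ḡ := Ḡ` such that
  (R1) `φ ∈ √(ḡ)` and `ḡ ∈ √(φ)` in `k[T]`  (same zero set: `V₊(ḡ) = V₊(φ)`),
  (R2) for every chart index `j`, the dehomogenisation `ḡ(T_j := 1)` generates a RADICAL ideal of `k[T_l : l ≠ j]`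
(both hold for `ḡ` = the square-free part of `φ`; (R1)/(R2) are the only properties of it that are used). Then:
* `radical_span_aeval_frac_sup_eq` — CHART ALGEBRA in `B_j = R[I/c_j]`, `t = c_j/1`: **`√((Φ(c/c_j)) + (t)) = (G(c/c_j)) + (t)`**
  (read modulo `t` on the exceptional divisor `B_j/(t) ≅ k[T_l : l ≠ j]` (`blowupAlgebraQuotEquiv`, Stacks 0BIQ), where the two
  ideals become `(φ_j)` and `(ḡ_j)` (res-type-100's `mk_coneTransform_eq`) and `√(φ_j) = (ḡ_j)` by (R1)+(R2)).
* `vanishingIdeal_carrierTrace_eq_radical` — presentation-free: `Z = √(St(𝓘_W) ⊔ E)` (part 1's support formula + Mathlib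
  `vanishingIdeal_support`).
* `stalkIdeal_vanishingIdeal_carrierTrace_of_presentation` — **the stalks of `Z`**: for `x'` over `x` and every dictionary
  presentation `(j, 𝔔, χ, e)` of `𝒪_{F',x'}` (p506193): `Z_{x'} = (χ G(c/c_j)) + (χ t)`; off `υ⁻¹{x}`: `Z_{x'} = ⊤`
  (`stalkIdeal_vanishingIdeal_carrierTrace_eq_top`).
* `vanishingIdeal_carrierTrace_eq_strictTransformIdeal_sup_comap` — **`Z = St(K_G) ⊔ E` as ideal sheaves** for every «cone» ideal
  sheaf `K_G` on `F` with `(K_G)_x = (G(c))`, when `G` is a FORM (of any degree `d'`, `ḡ ≠ 0`): the reduced trace `Z` IS the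
  scheme-theoretic intersection of `e` with the strict transform of the cone `V(G(c))` — T-TCONE (2) «`𝓘(Z) = 𝓘_e + (g)`».

References: The Stacks Project, Tags 052Q, 0804, 0BIQ — through the cited tree files; res-L1-w45b-lead-2 TARGET T-ISO-0⁺ /
skeleton v5.1 (OURS).
-/

set_option linter.dupNamespace false -- mandated namespace `Summit.<Summit>.<Problem>` of this single-conjunct summit

noncomputable section

open CategoryTheory AlgebraicGeometry TopologicalSpace Topology IsLocalRing
open Literature.AlgebraicGeometry.Resolution

namespace Summit.ResolutionOfSingularities.ResolutionOfSingularities.Cruxes.EquisingularLiftNat.Sections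

universe u

/-! ## Chart algebra: the radical of the trace ideal -/

section Chart

variable {R : Type u} [CommRing R] {r : ℕ} (c : Fin r → R) (j : Fin r)

/-- In a polynomial ring, if `a ∈ √(b)`, `b ∈ √(a)` and `(b)` is radical, then `√(a) = (b)`. (Stated for any commutative ring.)
[folklore] -/
theorem radical_span_singleton_eq_of_mem_radical {A : Type*} [CommRing A] {a b : A}
    (hab : a ∈ (Ideal.span {b}).radical) (hba : b ∈ (Ideal.span {a}).radical) (hb : (Ideal.span {b}).IsRadical) :
    (Ideal.span {a}).radical = Ideal.span {b} := by
  apply le_antisymm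
  · rw [hb.radical_le_iff, Ideal.span_singleton_le_iff_mem, ← hb.radical]
    exact hab
  · rw [Ideal.span_singleton_le_iff_mem]
    exact hba

/-- Radical memberships pass along ring homomorphisms: `a ∈ √(b) ⇒ f a ∈ √(f b)`. [folklore] -/
theorem map_mem_radical_span_singleton {A B : Type*} [CommRing A] [CommRing B] (f : A →+* B) {a b : A}
    (hab : a ∈ (Ideal.span {b}).radical) : f a ∈ (Ideal.span {f b}).radical := by
  obtain ⟨n, hn⟩ := hab
  obtain ⟨q, hq⟩ := Ideal.mem_span_singleton'.mp hn
  exact ⟨n, Ideal.mem_span_singleton'.mpr ⟨f q, by rw [← map_pow, ← hq, map_mul]⟩⟩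

/-- **The radical of the trace ideal on the chart.** On `B_j = R[I/c_j]` (`I = (c)` quasi-regular, `t = c_j/1`), for
`Φ, G ∈ R[T]` with reductions `φ, ḡ ∈ (R/I)[T]` satisfying (R1) `φ ∈ √(ḡ)`, `ḡ ∈ √(φ)` and (R2) `(ḡ(T_j := 1))` radical in
`(R/I)[T_l : l ≠ j]`: **`√((Φ(c/c_j)) + (t)) = (G(c/c_j)) + (t)`**. [cite: StacksProject, Tag 0BIQ] -/
theorem radical_span_aeval_frac_sup_eq (hc : IsQuasiRegular c) (Φ G : MvPolynomial (Fin r) R)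
    (hΦG : MvPolynomial.map (Ideal.Quotient.mk (Ideal.span (Set.range c))) Φ ∈
      (Ideal.span {MvPolynomial.map (Ideal.Quotient.mk (Ideal.span (Set.range c))) G}).radical)
    (hGΦ : MvPolynomial.map (Ideal.Quotient.mk (Ideal.span (Set.range c))) G ∈
      (Ideal.span {MvPolynomial.map (Ideal.Quotient.mk (Ideal.span (Set.range c))) Φ}).radical)
    (hGj : (Ideal.span {MvPolynomial.map (Ideal.Quotient.mk (Ideal.span (Set.range c))) (dehomogenize j G)}).IsRadical) :
    (Ideal.span {MvPolynomial.aeval (blowupAlgebra.frac c j) Φ} ⊔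
        Ideal.span {algebraMap R (blowupAlgebra (Ideal.span (Set.range c)) (c j)) (c j)}).radical =
      Ideal.span {MvPolynomial.aeval (blowupAlgebra.frac c j) G} ⊔
        Ideal.span {algebraMap R (blowupAlgebra (Ideal.span (Set.range c)) (c j)) (c j)} := by
  set B := blowupAlgebra (Ideal.span (Set.range c)) (c j) with hB
  set t : B := algebraMap R B (c j) with ht
  set kq := Ideal.Quotient.mk (Ideal.span (Set.range c)) with hkq
  set π := Ideal.Quotient.mk (Ideal.span {t}) with hπ
  set ε := blowupAlgebraQuotEquiv c j hc with hε
  -- the dehomogenised reductions `φ_j`, `ḡ_j` and their radical relation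
  set φj := MvPolynomial.map kq (dehomogenize j Φ) with hφj
  set gj := MvPolynomial.map kq (dehomogenize j G) with hgj
  have hrad : (Ideal.span {φj}).radical = Ideal.span {gj} := by
    have h1 : φj ∈ (Ideal.span {gj}).radical := by
      have := map_mem_radical_span_singleton (dehomogenize (R := R ⧸ Ideal.span (Set.range c)) j).toRingHom hΦG
      simpa only [hφj, hgj, map_dehomogenize, AlgHom.toRingHom_eq_coe, AlgHom.coe_toRingHom] using this
    have h2 : gj ∈ (Ideal.span {φj}).radical := by
      have := map_mem_radical_span_singleton (dehomogenize (R := R ⧸ Ideal.span (Set.range c)) j).toRingHom hGΦ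
      simpa only [hφj, hgj, map_dehomogenize, AlgHom.toRingHom_eq_coe, AlgHom.coe_toRingHom] using this
    exact radical_span_singleton_eq_of_mem_radical h1 h2 hGj
  -- the surjection `ψ : B_j → B_j/(t) ≅ k[T̂]` with kernel `(t)`, `ψ(Φ(e)) = φ_j`, `ψ(G(e)) = ḡ_j`
  set ψ : B →+* MvPolynomial {l : Fin r // l ≠ j} (R ⧸ Ideal.span (Set.range c)) := ε.symm.toRingHom.comp π with hψ
  have hψsurj : Function.Surjective ψ := ε.symm.surjective.comp Ideal.Quotient.mk_surjective
  have hψΦ : ψ (MvPolynomial.aeval (blowupAlgebra.frac c j) Φ) = φj := by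
    change ε.symm (π _) = φj
    rw [show π (MvPolynomial.aeval (blowupAlgebra.frac c j) Φ) = ε φj from mk_coneTransform_eq c j hc Φ,
      RingEquiv.symm_apply_apply]
  have hψG : ψ (MvPolynomial.aeval (blowupAlgebra.frac c j) G) = gj := by
    change ε.symm (π _) = gj
    rw [show π (MvPolynomial.aeval (blowupAlgebra.frac c j) G) = ε gj from mk_coneTransform_eq c j hc G,
      RingEquiv.symm_apply_apply]
  have hψt : ψ t = 0 := by
    change ε.symm (π t) = 0
    rw [show π t = 0 from Ideal.Quotient.eq_zero_iff_mem.mpr (Ideal.mem_span_singleton_self t), map_zero]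
  have hkerψ : RingHom.ker ψ = Ideal.span {t} := by
    ext z
    rw [RingHom.mem_ker]
    change ε.symm (π z) = 0 ↔ _
    rw [map_eq_zero_iff _ ε.symm.injective, Ideal.Quotient.eq_zero_iff_mem]
  -- both ideals contain `ker ψ`, so they are pulled back from their images `(φ_j)` and `(ḡ_j)`
  have hpull : ∀ (X : Ideal B) (y : B), Ideal.span {t} ≤ X → X = Ideal.span {y} ⊔ Ideal.span {t} →
      X = Ideal.comap ψ (Ideal.span {ψ y}) := by
    intro X y htX hX
    have h1 : Ideal.comap ψ (Ideal.map ψ X) = X := by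
      rw [Ideal.comap_map_of_surjective ψ hψsurj, ← RingHom.ker_eq_comap_bot, hkerψ, sup_eq_left]
      exact htX
    rw [← h1, hX, Ideal.map_sup, Ideal.map_span, Ideal.map_span, Set.image_singleton, Set.image_singleton, hψt,
      Ideal.span_singleton_zero, sup_bot_eq]
  have hA := hpull _ (MvPolynomial.aeval (blowupAlgebra.frac c j) Φ) le_sup_right rfl
  have hBg := hpull _ (MvPolynomial.aeval (blowupAlgebra.frac c j) G) le_sup_right rfl
  rw [hψΦ] at hA
  rw [hψG] at hBg
  rw [hA, hBg, ← Ideal.comap_radical, hrad]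

end Chart

/-! ## The reduced trace `Z` on the point blow-up -/

section PointCentre

variable {F F' : Scheme.{u}} {υ : F' ⟶ F} {x : F} (hx : IsClosed ({x} : Set F))

/-- Presentation-free form: **`Z = √(St(𝓘_W) ⊔ E)`** — the vanishing ideal of `e ∩ St(W) = υ⁻¹{x} ∩ closure υ⁻¹(W ∖ {x})` is the
radical of the ideal of the scheme-theoretic intersection (part 1's support formula + `vanishingIdeal_support`). [folklore] -/
theorem vanishingIdeal_carrierTrace_eq_radical [IsLocallyNoetherian F'] (W : Closeds F)
    (hZ : IsClosed (υ ⁻¹' {x} ∩ closure (υ ⁻¹' ((W : Set F) \ {x})))) :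
    Scheme.IdealSheafData.vanishingIdeal ⟨υ ⁻¹' {x} ∩ closure (υ ⁻¹' ((W : Set F) \ {x})), hZ⟩ =
      (strictTransformIdeal υ (Scheme.IdealSheafData.vanishingIdeal ⟨{x}, hx⟩)
          (Scheme.IdealSheafData.vanishingIdeal W) ⊔
        (Scheme.IdealSheafData.vanishingIdeal ⟨{x}, hx⟩).comap υ).radical := by
  rw [← Scheme.IdealSheafData.vanishingIdeal_support]
  congr 1
  exact Closeds.ext (coe_support_strictTransformIdeal_sup_comap_vanishingIdeal hx W).symm

/-- Off the exceptional locus the reduced trace is the unit ideal: `Z_{x'} = ⊤` for `υ x' ≠ x`. [folklore] -/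
theorem stalkIdeal_vanishingIdeal_carrierTrace_eq_top (W : Closeds F)
    (hZ : IsClosed (υ ⁻¹' {x} ∩ closure (υ ⁻¹' ((W : Set F) \ {x})))) {x' : F'} (hx' : υ x' ≠ x) :
    stalkIdeal (Scheme.IdealSheafData.vanishingIdeal ⟨υ ⁻¹' {x} ∩ closure (υ ⁻¹' ((W : Set F) \ {x})), hZ⟩) x' = ⊤ := by
  apply stalkIdeal_eq_top_of_not_mem_support
  intro h
  have : x' ∈ ((Scheme.IdealSheafData.vanishingIdeal
      (⟨υ ⁻¹' {x} ∩ closure (υ ⁻¹' ((W : Set F) \ {x})), hZ⟩ : Closeds F')).support : Set F') := h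
  rw [Scheme.IdealSheafData.coe_support_vanishingIdeal] at this
  exact hx' this.1

set_option maxHeartbeats 400000 in -- the chart algebra `blowupAlgebra` is a subalgebra of a localisation: slow instance unification (cf. p506193, p509910)
/-- **The stalks of the reduced trace `Z`** (everything read at the image point `υ x'`, as in res-type-100's stalk theorem; a
consumer with `υ x' = x` substitutes). `υ : F' → F` any morphism with `F'` locally Noetherian, `υ x'` closed, `c` a quasi-regular
system of generators of `𝔪_{υ x'}`, `W ⊆ F` closed with `𝓘(W)_{υ x'} = (Φ(c))`, `Φ` a form of degree `d` with reduction `φ ≠ 0`, and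
`G ∈ 𝒪_{F,υ x'}[T]` with reduction `ḡ` satisfying (R1) `φ ∈ √(ḡ)`, `ḡ ∈ √(φ)` and (R2) `(ḡ(T_j := 1))` radical for all `j`. Then for
EVERY dictionary presentation `(j, 𝔔, χ, e)` of `𝒪_{F',x'}` (p506193): **`Z_{x'} = (χ G(c/c_j)) + (χ t)`**,
`Z = vanishingIdeal (υ⁻¹{υ x'} ∩ closure υ⁻¹(W ∖ {υ x'}))`. [cite: StacksProject, Tag 0804] -/
theorem stalkIdeal_vanishingIdeal_carrierTrace_of_presentation [IsLocallyNoetherian F'] (x' : F')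
    (hx : IsClosed ({υ x'} : Set F)) {r : ℕ}
    (c : Fin r → F.presheaf.stalk (υ x')) (hc𝔪 : Ideal.span (Set.range c) = maximalIdeal (F.presheaf.stalk (υ x')))
    (hc : IsQuasiRegular c) (W : Closeds F) {d : ℕ} (Φ G : MvPolynomial (Fin r) (F.presheaf.stalk (υ x')))
    (hΦd : Φ.IsHomogeneous d) (hΦ : MvPolynomial.map (Ideal.Quotient.mk (Ideal.span (Set.range c))) Φ ≠ 0)
    (hW : stalkIdeal (Scheme.IdealSheafData.vanishingIdeal W) (υ x') = Ideal.span {MvPolynomial.eval c Φ})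
    (hΦG : MvPolynomial.map (Ideal.Quotient.mk (Ideal.span (Set.range c))) Φ ∈
      (Ideal.span {MvPolynomial.map (Ideal.Quotient.mk (Ideal.span (Set.range c))) G}).radical)
    (hGΦ : MvPolynomial.map (Ideal.Quotient.mk (Ideal.span (Set.range c))) G ∈
      (Ideal.span {MvPolynomial.map (Ideal.Quotient.mk (Ideal.span (Set.range c))) Φ}).radical)
    (hGrad : ∀ j, (Ideal.span {MvPolynomial.map (Ideal.Quotient.mk (Ideal.span (Set.range c)))
      (dehomogenize j G)}).IsRadical)
    (hZ : IsClosed (υ ⁻¹' {υ x'} ∩ closure (υ ⁻¹' ((W : Set F) \ {υ x'}))))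
    (j : Fin r) (𝔔 : PrimeSpectrum (blowupAlgebra (Ideal.span (Set.range c)) (c j)))
    (χ : blowupAlgebra (Ideal.span (Set.range c)) (c j) →+* F'.presheaf.stalk x')
    (e : F'.presheaf.stalk x' ≃+* Localization.AtPrime 𝔔.asIdeal)
    (hχ : ∀ a, χ (algebraMap _ _ a) = (υ.stalkMap x').hom a)
    (he : ∀ b, e (χ b) = algebraMap _ (Localization.AtPrime 𝔔.asIdeal) b) :
    stalkIdeal (Scheme.IdealSheafData.vanishingIdeal
        ⟨υ ⁻¹' {υ x'} ∩ closure (υ ⁻¹' ((W : Set F) \ {υ x'})), hZ⟩) x' =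
      Ideal.span {χ (MvPolynomial.aeval (blowupAlgebra.frac c j) G)} ⊔
        Ideal.span {χ (algebraMap _ (blowupAlgebra (Ideal.span (Set.range c)) (c j)) (c j))} := by
  set J := Scheme.IdealSheafData.vanishingIdeal (⟨{υ x'}, hx⟩ : Closeds F) with hJ
  haveI := isDomain_quotient_span_of_span_eq_maximalIdeal hc𝔪
  have hcJ : Ideal.span (Set.range c) = stalkIdeal J (υ x') := by rw [hc𝔪, hJ, stalkIdeal_vanishingIdeal_singleton hx]
  obtain ⟨-, -, h1⟩ := stalkIdeal_strictTransformIdeal_sup_comap_of_presentation (Scheme.IdealSheafData.vanishingIdeal W)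
    x' c hcJ hc Φ hΦd hΦ hW j 𝔔 χ e hχ he
  rw [vanishingIdeal_carrierTrace_eq_radical hx W hZ, stalkIdeal_radical, h1]
  -- transport the chart computation along the localisation `χ : B_j → 𝒪_{F',x'} ≅ (B_j)_𝔔`
  letI := χ.toAlgebra
  haveI : IsLocalization.AtPrime (F'.presheaf.stalk x') 𝔔.asIdeal := isLocalization_stalk_of_ringEquiv 𝔔 x' χ e he
  have key := congrArg (Ideal.map (algebraMap _ (F'.presheaf.stalk x')))
    (radical_span_aeval_frac_sup_eq c j hc Φ G hΦG hGΦ (hGrad j))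
  rw [IsLocalization.map_radical 𝔔.asIdeal.primeCompl (F'.presheaf.stalk x')] at key
  simp only [Ideal.map_sup, Ideal.map_span, Set.image_singleton, RingHom.algebraMap_toAlgebra] at key
  exact key

set_option maxHeartbeats 400000 in -- as above
/-- **T-TCONE (2): `Z = St(K_G) ⊔ E` — the reduced exceptional trace of `St(W)` IS the scheme-theoretic intersection of the
exceptional divisor with the strict transform of the cone `V(G(c))`.** Point blow-up `υ : F' → F` of the closed point `x`
(`IsBlowup υ 𝓘_{x}`, `F'` locally Noetherian), `c` a quasi-regular system of generators of `𝔪_x`, `W ⊆ F` closed with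
`𝓘(W)_x = (Φ(c))` (`Φ` a form of degree `d`, `φ = Φ̄ ≠ 0`), `G` a FORM of degree `d'` with `ḡ = Ḡ ≠ 0`, (R1) `φ ∈ √(ḡ)`, `ḡ ∈ √(φ)`,
(R2) `(ḡ(T_j := 1))` radical for all `j`, and `K_G` any ideal sheaf on `F` with `(K_G)_x = (G(c))`. Then
`vanishingIdeal (υ⁻¹{x} ∩ closure υ⁻¹(W ∖ {x})) = St(K_G) ⊔ E`. [cite: StacksProject, Tag 0804] -/
theorem vanishingIdeal_carrierTrace_eq_strictTransformIdeal_sup_comap [IsLocallyNoetherian F']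
    (hυ : IsBlowup υ (Scheme.IdealSheafData.vanishingIdeal ⟨{x}, hx⟩)) {r : ℕ}
    (c : Fin r → F.presheaf.stalk x) (hc𝔪 : Ideal.span (Set.range c) = maximalIdeal (F.presheaf.stalk x))
    (hc : IsQuasiRegular c) (W : Closeds F) (K : F.IdealSheafData) {d d' : ℕ}
    (Φ G : MvPolynomial (Fin r) (F.presheaf.stalk x)) (hΦd : Φ.IsHomogeneous d) (hGd : G.IsHomogeneous d')
    (hΦ : MvPolynomial.map (Ideal.Quotient.mk (Ideal.span (Set.range c))) Φ ≠ 0)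
    (hG : MvPolynomial.map (Ideal.Quotient.mk (Ideal.span (Set.range c))) G ≠ 0)
    (hW : stalkIdeal (Scheme.IdealSheafData.vanishingIdeal W) x = Ideal.span {MvPolynomial.eval c Φ})
    (hK : stalkIdeal K x = Ideal.span {MvPolynomial.eval c G})
    (hΦG : MvPolynomial.map (Ideal.Quotient.mk (Ideal.span (Set.range c))) Φ ∈
      (Ideal.span {MvPolynomial.map (Ideal.Quotient.mk (Ideal.span (Set.range c))) G}).radical)
    (hGΦ : MvPolynomial.map (Ideal.Quotient.mk (Ideal.span (Set.range c))) G ∈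
      (Ideal.span {MvPolynomial.map (Ideal.Quotient.mk (Ideal.span (Set.range c))) Φ}).radical)
    (hGrad : ∀ j, (Ideal.span {MvPolynomial.map (Ideal.Quotient.mk (Ideal.span (Set.range c)))
      (dehomogenize j G)}).IsRadical)
    (hZ : IsClosed (υ ⁻¹' {x} ∩ closure (υ ⁻¹' ((W : Set F) \ {x})))) :
    Scheme.IdealSheafData.vanishingIdeal ⟨υ ⁻¹' {x} ∩ closure (υ ⁻¹' ((W : Set F) \ {x})), hZ⟩ =
      strictTransformIdeal υ (Scheme.IdealSheafData.vanishingIdeal ⟨{x}, hx⟩) K ⊔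
        (Scheme.IdealSheafData.vanishingIdeal ⟨{x}, hx⟩).comap υ := by
  set J := Scheme.IdealSheafData.vanishingIdeal (⟨{x}, hx⟩ : Closeds F) with hJ
  refine ext_of_forall_stalkIdeal_eq fun x' => ?_
  by_cases hx' : υ x' = x
  · subst hx'
    haveI := isDomain_quotient_span_of_span_eq_maximalIdeal hc𝔪
    have hcJ : Ideal.span (Set.range c) = stalkIdeal J (υ x') := by rw [hc𝔪, hJ, stalkIdeal_vanishingIdeal_singleton hx]
    obtain ⟨j, 𝔔, χ, e, hχ, he, -⟩ :=
      exists_blowupAlgebra_stalk_ringEquiv_of_eq hυ x' c (Ideal.span (Set.range c)) rfl hcJ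
    obtain ⟨-, -, h2⟩ := stalkIdeal_strictTransformIdeal_sup_comap_of_presentation K x' c hcJ hc G hGd hG hK
      j 𝔔 χ e hχ he
    rw [h2]
    exact stalkIdeal_vanishingIdeal_carrierTrace_of_presentation x' hx c hc𝔪 hc W Φ G hΦd hΦ hW hΦG hGΦ hGrad hZ
      j 𝔔 χ e hχ he
  · have hE : stalkIdeal (J.comap υ) x' = ⊤ := by
      apply stalkIdeal_eq_top_of_not_mem_support
      intro h
      apply hx'
      have : x' ∈ ((J.comap υ).support : Set F') := h
      rw [Scheme.IdealSheafData.support_comap, hJ] at this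
      have : υ x' ∈ ((Scheme.IdealSheafData.vanishingIdeal (⟨{x}, hx⟩ : Closeds F)).support : Set F) := this
      rw [Scheme.IdealSheafData.coe_support_vanishingIdeal] at this
      exact this
    rw [stalkIdeal_vanishingIdeal_carrierTrace_eq_top W hZ hx', stalkIdeal_sup, hE, sup_top_eq]

end PointCentre

end Summit.ResolutionOfSingularities.ResolutionOfSingularities.Cruxes.EquisingularLiftNat.Sections

end
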